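import Summits.Langlands.Langlands.Theorems.ParityBlindBianchiIcosahedralDescentLevelOfBianchiArtin
import HarnessLib

/-!
# Crux stmt-Langlands-15113 `IcosahedralDescentLevel` AS TYPED — closed MODULO the registered stubs of
# line `DoorFromOwnChain` (skeleton v4, sha cef629dc…; lead c12, `--workitem stmt-Langlands-15113`)

The registered skeleton `Cruxes/IcosahedralDescentLevel/Lines/DoorFromOwnChain.lean` concludes the crux by
name (`IcosahedralDescentLevel_of`) from four `sorry`d stubs: three NAMED-FACT bundles (seven printed
theorems filed as named facts of the tree, undischarged Literature debt — `khare_wintenberger` for every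
`p`, and Arthur–Clozel Ch. 3: `baseChange_cyclic_cuspidal`, `ArthurClozel1989_strongLifting_archimedean`,
`…_allFinite`, `…_unramified`, `cuspidal_descent_cyclic`, `ArthurClozel_fibres_quadratic`) and ONE crux
stub `stub_bianchiArtin` (the route's thesis E2′ ∘ R′ at the single consumed instance: `p = 2`,
restrictions `σ₀|_{Γ_K}` of 2-adic representations of `Γ_ℚ`, prime-only bad set `S ∋ 2`; it follows from
the open cruxes stmt-Langlands-15110 ∧ stmt-Langlands-15111 by the landed `bianchiArtin_of_thesis`, and its
even sector contains the open even-icosahedral Artin problem).  This file is that composition with the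
four `sorry`s turned into hypotheses — the strongest sorry-free statement about the TYPED crux on this
line: a CONDITIONAL result (`proof.conditional`; closure.modulo = the seven facts + the stub statement;
credits nothing until they are discharged).  The transfer it invokes, `stub_artinOfBianchiArtin`, is the
landed p121513; the sibling wiring with E2′, R′ themselves as hypotheses is `icosahedralDescentLevel_of_thesis`
(p121025, `--supports`).  Kernel-checked context (why nothing sharper exists): with NO hypothesis the typed
crux is EQUIVALENT to the open rank-0 target `GaloisWeightedBE.StrongArtinIcosahedralQ` (stmt-Langlands-10841;
`iff_strongArtinIcosahedralQ`, p116764), because its binder `∃ S₀ : Finset ℕ` admits `S₀ = {0}`, which voids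
the compatibility clause; the REPAIRED statement (`0 ∉ S₀`) is proved modulo four of the seven facts
(`icosahedralDescentLevel_repaired`, p111861).
-/

set_option linter.dupNamespace false

noncomputable section

open scoped NumberField
open NumberField IsDedekindDomain
open Literature.NumberTheory.Automorphic Literature.NumberTheory.GaloisRepresentations
open Summit.Langlands.Langlands.Theses.ParityBlindBianchi

namespace Summit.Langlands.Langlands.Theorems.IcosahedralDescentLevel

/-- **The typed crux modulo the registered stubs of line `DoorFromOwnChain`.**  The seven printed named
facts of the tree (Khare–Wintenberger for every `p`; Arthur–Clozel Ch. 3 ×6) and the crux stub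
`stub_bianchiArtin` (E2′ ∘ R′ at `p = 2` on restrictions `σ₀|_{Γ_K}`, prime-only `S ∋ 2`; implied by
stmt-Langlands-15110 ∧ stmt-Langlands-15111 via `bianchiArtin_of_thesis`) imply `IcosahedralDescentLevel`
AS TYPED: the conclusion is the landed transfer `stub_artinOfBianchiArtin` (p121513); the crux's own
uniform-family hypothesis is discarded (vacuous at `S₀ = {0}`). This is the registered skeleton's
composition `IcosahedralDescentLevel_of` with its four `sorry`d stubs turned into hypotheses. [folklore] -/
theorem icosahedralDescentLevel_of_stubs
    (hKW : ∀ (p : ℕ) [Fact p.Prime] (k : Type) [Field k] [TopologicalSpace k] [DiscreteTopology k],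
      khare_wintenberger p k)
    (hBC : baseChange_cyclic_cuspidal) (hArch : ArthurClozel1989_strongLifting_archimedean)
    (hR1 : ArthurClozel1989_strongLifting_allFinite) (hdesc : cuspidal_descent_cyclic)
    (hSL : ArthurClozel1989_strongLifting_unramified) (hfib : ArthurClozel_fibres_quadratic)
    (hX : ∀ (K : Type) [Field K] [NumberField K], NumberField.IsTotallyComplex K → Module.finrank ℚ K = 2 →
      (∃ v w : HeightOneSpectrum (𝓞 K), v ≠ w ∧ ((2 : ℕ) : 𝓞 K) ∈ v.asIdeal ∧ ((2 : ℕ) : 𝓞 K) ∈ w.asIdeal) →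
      ∀ (ι : PadicAlgCl 2 ≃+* ℂ) (σ₀ : FramedGaloisRep ℚ (PadicAlgCl 2) 2),
        Finite (σ₀.restrictField K).toMonoidHom.range →
        (σ₀.restrictField K).toGaloisRep.IsIrreducible →
        Nonempty ((Matrix.ProjGenLinGroup.mk.comp (σ₀.restrictField K).toMonoidHom).range ≃*
          alternatingGroup (Fin 5)) →
        ∀ S : Finset ℕ, 2 ∈ S → (∀ ℓ ∈ S, ℓ.Prime) →
          (∃ (hcpt : isCompact_glFiniteIntegralLevel 2 K) (π₀ : CuspidalAutomorphicRepData 2 K hcpt),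
              π₀.1.IsRegularAlgebraic ∧
                ∀ v : HeightOneSpectrum (𝓞 K), (∀ ℓ ∈ S, ((ℓ : ℕ) : 𝓞 K) ∉ v.asIdeal) →
                  ∃ (α : Multiset ℂ) (P : Polynomial (PadicAlgCl 2)), π₀.1.HasSatakeParamAt v α ∧
                    (σ₀.restrictField K).IsUnramifiedAt v ∧ (σ₀.restrictField K).HasFrobCharpolyAt v P ∧
                      ∀ i : ℕ, ‖P.coeff i - (arithFrobPolyOfSatake ι v.residueCard 2 α).coeff i‖ < 1) →
          ∃ (hcpt : isCompact_glFiniteIntegralLevel 2 K) (π : CuspidalAutomorphicRepData 2 K hcpt),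
            ∀ w : HeightOneSpectrum (𝓞 K), (∀ ℓ ∈ S, ((ℓ : ℕ) : 𝓞 K) ∉ w.asIdeal) →
              Summit.Langlands.SatakeFrobCompatibleAt ι π.1 (σ₀.restrictField K) w) :
    IcosahedralDescentLevel :=
  fun ι ρ hirr hA5 _ => stub_artinOfBianchiArtin hKW hBC hArch hR1 hdesc hSL hfib hX ι ρ hirr hA5

end Summit.Langlands.Langlands.Theorems.IcosahedralDescentLevel

end
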